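import Literature.Computability.Cryptography.RegevBDDToLWESample
import Literature.Computability.Cryptography.IIDStatisticalDistance
import Literature.Computability.Cryptography.LWERegevTransforms
import HarnessLib

/-!
# Regev 2009, Lemma 3.11 with an approximate `D_{L,r}`-sampler, `N` independent samples, and the secret shift

Topic `Computability/Cryptography` (family `pqc`), grouping namespace `Regev2009`; sequel of
`RegevBDDToLWESample.lean` (Lemma 3.11: one manufactured sample from an exact `v ← D_{L,r}` is within
`6ε` of `A_{s,Ψ̄_β}`). Everything here is PROVED; one definition with body (`bddLWESampleOf`, the sample
map on an arbitrary source of lattice vectors) and theorems; no named fact.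

This packages the three bookkeeping steps between Lemma 3.11 and the call to the `LWE` oracle in
Regev's Lemma 3.4 = Peikert's Prop. 3.2 (hypothesis `h₂` of
`Literature.Computability.Cryptography.peikert_gapSVPZeta_to_lwe_classical_of_components`, pqc.S20; also
Regev's Thm. 3.1, pqc.S19):

* the discrete Gaussian samples are only APPROXIMATE (Peikert's Prop. 2.8 = GPV Thm. 4.1: a sampler
  within negligible statistical distance `δ` of `D_{Λ*,r}`) — `tvDist_bddLWESampleOf_lweSample_le`:
  `Δ ≤ δ + 6ε` (data processing for the common kernel, tree `PMF.tvDist_bind_left_le`);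
* the oracle consumes `N = m(n)` INDEPENDENT samples ("by running this procedure a polynomial number of
  times and then using `W`") — `tvDist_iidPMF_bddLWESampleOf_lweSamples_le`: `Δ(N runs, A_{s,Ψ̄_β}^N) ≤
  N(δ + 6ε)` (hybrid bound, tree `LWE.tvDist_iidPMF_le`);
* the oracle of pqc.S19/S20 is AVERAGE-case over a uniform secret, while the manufactured samples have
  the fixed secret `s = (L*)⁻¹κ mod p`; Regev's shift `(a, b) ↦ (a, b + ⟨a, t⟩)` (proof of Lemma 4.1)
  turns them into samples for `s + t` — `tvDist_iidPMF_bddLWESampleOf_shift_le` (tree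
  `LWE.lweSamples_map_shift`); with `t` uniform, `s + t` is uniform.

## References

* O. Regev, *On lattices, learning with errors, random linear codes, and cryptography*, J. ACM 56
  (2009), art. 34 = arXiv:2401.03703, Lemma 3.11 (proof), Lemma 4.1 (proof) [RegevLWE2009].
* C. Peikert, *Public-key cryptosystems from the worst-case shortest vector problem*, STOC 2009,
  Prop. 3.2 with Prop. 2.8 [Peikert2009].
-/

noncomputable section

open MeasureTheory ProbabilityTheory Module Literature.Algebra.EuclideanLattices
open scoped Real ENNReal InnerProductSpace NNReal

namespace Literature.Computability.Cryptography

namespace Regev2009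

variable {E : Type*} [NormedAddCommGroup E] [InnerProductSpace ℝ E] [FiniteDimensional ℝ E]
  [MeasurableSpace E] [BorelSpace E]
variable {L : Submodule ℤ E} [DiscreteTopology L] [IsZLattice ℝ L]
variable {ι : Type} [Fintype ι] [DecidableEq ι] (b : Basis ι ℤ L) (p : ℕ) [NeZero p]

/-- LOCAL GLUE. Regev's sample map run on an ARBITRARY source `D` of lattice vectors (an approximate
sampler for `D_{L,r}`, e.g. the GPV sampler of Peikert's Prop. 2.8): `v ← D`, output
`(L⁻¹v mod p, ⌊p(⟪x, v⟫/p + e)⌉ mod p)`, `e ∼ N(0, α₀²/(2π))`. [cite: RegevLWE2009, Lemma 3.11 (proof, Eq. (10))] -/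
def bddLWESampleOf (D : PMF L) (x : E) (α₀ : ℝ) : PMF ((ι → ZMod p) × ZMod p) :=
  D.bind fun v => (noiseZMod p α₀ (⟪x, (v : E)⟫_ℝ / p)).map fun k => (coeffMod b p v, k)

omit [MeasurableSpace E] [BorelSpace E] [IsZLattice ℝ L] [Fintype ι] [DecidableEq ι] in
/-- With the exact sampler this is `bddLWESample`. [folklore] -/
theorem bddLWESampleOf_discreteGaussian (x : E) (r α₀ : ℝ) :
    bddLWESampleOf b p (discreteGaussian L r 0) x α₀ = bddLWESample b p x r α₀ := rfl

/-- **Lemma 3.11 with an approximate sampler.** If the source `D` of lattice vectors is within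
statistical distance `δ` of `D_{L,r}` (Peikert's Prop. 2.8 / GPV Thm. 4.1 give `δ` negligible), then under
the hypotheses of `tvDist_bddLWESample_lweSample_le` the manufactured sample is within `δ + 6ε` of
`A_{s,Ψ̄_β}` (data processing for the common kernel, `PMF.tvDist_bind_left_le`, then the exact case).
[cite: RegevLWE2009, Lemma 3.11 (proof); Peikert2009, Prop. 3.2 with Prop. 2.8] -/
theorem tvDist_bddLWESampleOf_lweSample_le (D : PMF L) {δ ε r α₀ : ℝ}
    (hD : D.tvDist (discreteGaussian L r 0) ≤ δ) (hε : 0 < ε) (hε' : ε ≤ 1 / 2) (hr : 0 < r)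
    (hα : 0 < α₀) (hη : Real.sqrt 2 * p * smoothingParameter L ε ≤ r) {x κ : E}
    (hκ : κ ∈ dualLattice L) (hx : r * ‖x - κ‖ ≤ α₀ * p) :
    (bddLWESampleOf b p D x α₀).tvDist
      (LWE.lweSample (LWE.discretizedGaussian p (Real.sqrt ((r * ‖x - κ‖ / p) ^ 2 + α₀ ^ 2)))
        (secretOf b p κ)) ≤ δ + 6 * ε := by
  refine (PMF.tvDist_triangle_holds _ (bddLWESample b p x r α₀) _).trans (add_le_add ?_ ?_)
  · rw [← bddLWESampleOf_discreteGaussian]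
    exact (PMF.tvDist_bind_left_le _ _ _).trans hD
  · exact tvDist_bddLWESample_lweSample_le b p hε hε' hr hα hη hκ hx

/-- **`N` independent manufactured samples** ("By running this procedure a polynomial number of times
and then using `W`, we can find `s`", Regev 2009, proof of Lemma 3.11): `N` independent runs of the
sample map on an approximate sampler are within `N(δ + 6ε)` of `N` genuine samples `A_{s,Ψ̄_β}^N`
(`LWE.lweSamples`), by the hybrid bound `Δ(P^{⊗N}, Q^{⊗N}) ≤ N·Δ(P, Q)` (tree: `LWE.tvDist_iidPMF_le`).
[cite: RegevLWE2009, Lemma 3.11 (proof)] -/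
theorem tvDist_iidPMF_bddLWESampleOf_lweSamples_le (D : PMF L) {δ ε r α₀ : ℝ}
    (hD : D.tvDist (discreteGaussian L r 0) ≤ δ) (hε : 0 < ε) (hε' : ε ≤ 1 / 2) (hr : 0 < r)
    (hα : 0 < α₀) (hη : Real.sqrt 2 * p * smoothingParameter L ε ≤ r) {x κ : E}
    (hκ : κ ∈ dualLattice L) (hx : r * ‖x - κ‖ ≤ α₀ * p) (N : ℕ) :
    (LWE.iidPMF (bddLWESampleOf b p D x α₀) N).tvDist
      (LWE.lweSamples (LWE.discretizedGaussian p (Real.sqrt ((r * ‖x - κ‖ / p) ^ 2 + α₀ ^ 2)))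
        (secretOf b p κ) N) ≤ N * (δ + 6 * ε) := by
  unfold LWE.lweSamples
  refine (LWE.tvDist_iidPMF_le _ _ N).trans ?_
  exact mul_le_mul_of_nonneg_left
    (tvDist_bddLWESampleOf_lweSample_le b p D hD hε hε' hr hα hη hκ hx) (Nat.cast_nonneg N)

/-- **Re-randomising the secret** (Regev 2009, proof of Lemma 4.1: "`(a, b) ↦ (a, b + ⟨a, t⟩)` maps
`A_{s,χ}` to `A_{s+t,χ}`"), transported to the manufactured samples: shifting `N` manufactured samples by
`t` keeps them within `N(δ + 6ε)` of `A_{s+t,Ψ̄_β}^N` (the shift is a bijection applied to both laws;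
tree: `LWE.lweSamples_map_shift`, data processing `PMF.tvDist_map_le_holds`). With `t` uniform the
secret `s + t` is uniform, which is how an AVERAGE-case `LWE` oracle (pqc.S19/S20 format) is served.
[cite: RegevLWE2009, Lemma 4.1 (proof) and Lemma 3.11] -/
theorem tvDist_iidPMF_bddLWESampleOf_shift_le (D : PMF L) {δ ε r α₀ : ℝ}
    (hD : D.tvDist (discreteGaussian L r 0) ≤ δ) (hε : 0 < ε) (hε' : ε ≤ 1 / 2) (hr : 0 < r)
    (hα : 0 < α₀) (hη : Real.sqrt 2 * p * smoothingParameter L ε ≤ r) {x κ : E}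
    (hκ : κ ∈ dualLattice L) (hx : r * ‖x - κ‖ ≤ α₀ * p) (N : ℕ) (t : ι → ZMod p) :
    ((LWE.iidPMF (bddLWESampleOf b p D x α₀) N).map fun S => LWE.shiftSample t ∘ S).tvDist
      (LWE.lweSamples (LWE.discretizedGaussian p (Real.sqrt ((r * ‖x - κ‖ / p) ^ 2 + α₀ ^ 2)))
        (secretOf b p κ + t) N) ≤ N * (δ + 6 * ε) := by
  rw [← LWE.lweSamples_map_shift]
  exact (PMF.tvDist_map_le_holds _ _ _).trans
    (tvDist_iidPMF_bddLWESampleOf_lweSamples_le b p D hD hε hε' hr hα hη hκ hx N)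

end Regev2009

end Literature.Computability.Cryptography
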